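import Summits.CriticalPhenomena.PercolationContinuityZ3.Theorems.PercNearOneGluingNoHeavyLowerTailKNGoodNotLonely
import HarnessLib

/-!
# Kozma–Nitzan GOODNESS: one lonely child and any number of non-lonely ones
# (`NoHeavyLowerTail` cell, stmt-CriticalPhenomena-4575; prover `prim-hp-2`, deletion–contraction line, gen 3)

Support file (`--supports stmt-CriticalPhenomena-4575`).  No definitions, no named facts, no sorries.

Kozma–Nitzan's Theorem 5 (arXiv:2401.12397 p. 13; tree `KozmaNitzanGoodQuadruple`) propagates goodness from ONE neighbour `x` of the
observer `o` (with `(G∖o, A, x, b)` good, `x` otherwise arbitrary) plus relay hairs.  `KNGoodHair.knGood_mono_pair` lets further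
pairs be attached at `o` provided they lead to vertices that are NOT LONELY (at least as connected to `b` as the loneliest relay).
Combining the two:

* `KNGoodOneLonelyChild.restrW_compl_singleton_eq_of_eqOff` — `G ∖ o` does not see the pairs at `o`.
* `KNGoodOneLonelyChild.knGood_of_base_notLonely` — the iteration behind `KNGoodNotLonely.knGood_of_notLonely_neighbours`, with an
  ARBITRARY good base: if `G₀ = G` with the pairs `o–X` closed is good at `o` and every `x' ∈ X` satisfies
  `min_a P_G(a ↔ b) ≤ P_{G₀}(x' ↔ b)`, then `G` is good at `o`.
* `KNGoodOneLonelyChild.knGood_thm5_notLonely` — **`o ∉ A` with positive pairs to relays, to ONE vertex `x` with `(G∖o, A, x, b)` good,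
  and to a finite set `X` of further vertices each at least as connected to `b` in `G₀` (pairs `o–X` closed) as the loneliest relay is
  in `G`: then `(G, A, o, b)` is good.**  The whole structure beyond `x` and `X` is arbitrary.

So in the goodness induction of this line a branching observer is handled whenever AT MOST ONE of its Steiner children is lonely;
the residual (seat notes, Conjecture M / GC) is exactly the gluing of TWO OR MORE lonely children.
-/

noncomputable section

namespace Summit.CriticalPhenomena.PercolationContinuityZ3.Theorems

open MeasureTheory Set Literature.Probability.LatticeModels Literature.Probability.Percolation
open scoped Classical BigOperators

variable {n : ℕ}

namespace KNGoodOneLonelyChild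

open KNGoodHair KNGoodNotLonely

/-- Weight functions that agree off the pairs at `o` have the same restriction to `{o}ᶜ`. [folklore] -/
theorem restrW_compl_singleton_eq_of_eqOff (w w' : Sym2 (Fin n) → unitInterval) (o : Fin n)
    (h : ∀ e : Sym2 (Fin n), o ∉ e → w' e = w e) :
    restrW ({o}ᶜ : Set (Fin n)) w' = restrW ({o}ᶜ : Set (Fin n)) w := by
  funext e
  by_cases he : e ∈ wireSet ({o}ᶜ : Set (Fin n))
  · rw [restrW_apply_of_mem w' he, restrW_apply_of_mem w he]
    exact h e fun hoe => he.1 o hoe rfl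
  · rw [restrW_apply_of_not_mem w' he, restrW_apply_of_not_mem w he]

/-- **Raising pairs at the observer towards non-lonely vertices, from an arbitrary good base.**  `X` a finite set of vertices
`≠ o`, `G₀ = G` with the pairs `o–X` closed; if `(G₀, A, o, b)` is good and `min_a P_G(a ↔ b) ≤ P_{G₀}(x ↔ b)` for all `x ∈ X`,
then `(G, A, o, b)` is good. [cite: KozmaNitzan2024, §3.2 (p. 12), Thm. 5 (p. 13) — extension] -/
theorem knGood_of_base_notLonely (w : Sym2 (Fin n) → unitInterval) (A : Finset (Fin n)) (hA : A.Nonempty)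
    (o b : Fin n) (X : Finset (Fin n)) (hX : ∀ x ∈ X, x ≠ o)
    (hbase : KNGood (fun e => if ∃ x ∈ X, e = s(o, x) then 0 else w e) A hA o b)
    (hnl : ∀ x ∈ X, A.inf' hA (fun a => (prodBernoulli w).real (openConn a b)) ≤
      (prodBernoulli (fun e => if ∃ x ∈ X, e = s(o, x) then 0 else w e)).real (openConn x b)) :
    KNGood w A hA o b := by
  set w₀ : Sym2 (Fin n) → unitInterval := fun e => if ∃ x ∈ X, e = s(o, x) then 0 else w e with hw₀
  have key : ∀ (m : ℕ) (w' : Sym2 (Fin n) → unitInterval),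
      (Finset.univ.filter fun e : Sym2 (Fin n) => w' e ≠ w e).card = m →
      (∀ e : Sym2 (Fin n), w' e ≠ w e → ∃ x ∈ X, e = s(o, x)) →
      (∀ e : Sym2 (Fin n), w' e ≤ w e) → (∀ e : Sym2 (Fin n), w₀ e ≤ w' e) →
      KNGood w' A hA o b → KNGood w A hA o b := by
    intro m
    induction m with
    | zero =>
      intro w' hm _ _ _ hgood
      have hww : w' = w := by
        funext e
        by_contra hne
        have : e ∈ (Finset.univ.filter fun e : Sym2 (Fin n) => w' e ≠ w e) :=
          Finset.mem_filter.2 ⟨Finset.mem_univ _, hne⟩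
        rw [Finset.card_eq_zero] at hm
        rw [hm] at this
        exact Finset.notMem_empty e this
      rwa [hww] at hgood
    | succ m ih =>
      intro w' hm hdiff hle hge hgood
      obtain ⟨e, he⟩ := Finset.card_pos.1 (by omega : 0 < (Finset.univ.filter fun e : Sym2 (Fin n) => w' e ≠ w e).card)
      have hne : w' e ≠ w e := (Finset.mem_filter.1 he).2
      obtain ⟨x, hx, rfl⟩ := hdiff e hne
      have hxo : x ≠ o := hX x hx
      set w'' : Sym2 (Fin n) → unitInterval := Function.update w' s(o, x) (w s(o, x)) with hw''
      have hgood'' : KNGood w'' A hA o b := by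
        have h1 : Function.update w'' s(o, x) (w' s(o, x)) = w' := by
          rw [hw'', Function.update_idem, Function.update_eq_self]
        refine knGood_mono_pair w'' A hA o b x hxo (w' s(o, x)) ?_ (by rw [h1]; exact hgood) ?_
        · rw [hw'', Function.update_self]; exact hle _
        · rw [h1]
          have hm1 : A.inf' hA (fun a => (prodBernoulli w').real (openConn a b)) ≤
              A.inf' hA (fun a => (prodBernoulli w).real (openConn a b)) := by
            refine (Finset.le_inf'_iff hA _).2 fun a ha => ?_
            exact (Finset.inf'_le _ ha).trans (real_openConn_mono a b _ w w' rfl hle)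
          exact hm1.trans ((hnl x hx).trans (real_openConn_mono x b _ w' w₀ rfl hge))
      have hcount : (Finset.univ.filter fun e : Sym2 (Fin n) => w'' e ≠ w e).card = m := by
        have hset : (Finset.univ.filter fun e : Sym2 (Fin n) => w'' e ≠ w e) =
            (Finset.univ.filter fun e : Sym2 (Fin n) => w' e ≠ w e).erase s(o, x) := by
          ext e'
          simp only [Finset.mem_filter, Finset.mem_univ, true_and, Finset.mem_erase]
          by_cases h : e' = s(o, x)
          · subst h; simp [hw'']
          · simp [hw'', h]
        rw [hset, Finset.card_erase_of_mem he, hm]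
        rfl
      refine ih w'' hcount ?_ ?_ ?_ hgood''
      · intro e' hne'
        by_cases h : e' = s(o, x)
        · exact ⟨x, hx, h⟩
        · have : w' e' ≠ w e' := by rwa [hw'', Function.update_of_ne h] at hne'
          exact hdiff e' this
      · intro e'
        by_cases h : e' = s(o, x)
        · subst h; rw [hw'', Function.update_self]
        · rw [hw'', Function.update_of_ne h]; exact hle e'
      · intro e'
        by_cases h : e' = s(o, x)
        · subst h; rw [hw'', Function.update_self]; exact (hge _).trans (hle _)
        · rw [hw'', Function.update_of_ne h]; exact hge e'
  refine key _ w₀ rfl ?_ ?_ (fun e => le_rfl) hbase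
  · intro e hne
    by_contra h
    apply hne
    rw [hw₀]; simp only
    rw [if_neg h]
  · intro e
    rw [hw₀]; simp only
    by_cases h : ∃ x ∈ X, e = s(o, x)
    · rw [if_pos h]; exact unitInterval.nonneg _
    · rw [if_neg h]

/-- **Theorem 5 with extra non-lonely neighbours.**  `o ∉ A`, `x ≠ o`, `X` a finite set of vertices `≠ o, x`; every positive pair
at `o` goes into `A ∪ {x} ∪ X`; `(G ∖ o, A, x, b)` is good (`G ∖ o = restrW {o}ᶜ w`); and, with `G₀ = G` with the pairs `o–X`
closed, `min_a P_G(a ↔ b) ≤ P_{G₀}(x' ↔ b)` for every `x' ∈ X`.  Then `(G, A, o, b)` is good.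
[cite: KozmaNitzan2024, Thm. 5 (p. 13) — extension] -/
theorem knGood_thm5_notLonely (w : Sym2 (Fin n) → unitInterval) (A : Finset (Fin n)) (hA : A.Nonempty)
    (o b x : Fin n) (X : Finset (Fin n)) (ho : o ∉ A) (hbo : b ≠ o) (hxo : x ≠ o) (hX : ∀ x' ∈ X, x' ≠ o ∧ x' ≠ x)
    (hiso : ∀ u : Fin n, u ≠ o → u ∉ A → u ≠ x → u ∉ X → w s(o, u) = 0)
    (hgoodx : KNGood (restrW ({o}ᶜ : Set (Fin n)) w) A hA x b)
    (hnl : ∀ x' ∈ X, A.inf' hA (fun a => (prodBernoulli w).real (openConn a b)) ≤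
      (prodBernoulli (fun e => if ∃ x' ∈ X, e = s(o, x') then 0 else w e)).real (openConn x' b)) :
    KNGood w A hA o b := by
  set w₀ : Sym2 (Fin n) → unitInterval := fun e => if ∃ x' ∈ X, e = s(o, x') then 0 else w e with hw₀
  refine knGood_of_base_notLonely w A hA o b X (fun x' hx' => (hX x' hx').1) ?_ hnl
  -- Theorem 5 at the base graph `G₀`
  have hrestr : restrW ({o}ᶜ : Set (Fin n)) w₀ = restrW ({o}ᶜ : Set (Fin n)) w := by
    refine restrW_compl_singleton_eq_of_eqOff w w₀ o fun e hoe => ?_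
    rw [hw₀]; simp only
    rw [if_neg]
    rintro ⟨x', -, rfl⟩
    exact hoe (Sym2.mem_mk_left o x')
  refine KozmaNitzan2024_thm5 w₀ A hA o b x ho hbo hxo (fun u huo huA hux => ?_) (by rw [hrestr]; exact hgoodx)
  by_cases huX : u ∈ X
  · rw [hw₀]; simp only; rw [if_pos ⟨u, huX, rfl⟩]
  · rw [hw₀]; simp only
    rw [if_neg]
    · exact hiso u huo huA hux huX
    · rintro ⟨x', hx', hux'⟩
      exact huX ((Sym2.congr_right.1 hux') ▸ hx')

end KNGoodOneLonelyChild

end Summit.CriticalPhenomena.PercolationContinuityZ3.Theorems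

end
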